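import Summits.QuantumFields.YangMills.Theorems.UnitScaleTiltProp8FlatSmallSolution158Levels
import Summits.QuantumFields.YangMills.Theorems.UnitScaleTiltProp8FlatChart47Levels
import Literature.MathematicalPhysics.QuantumFieldTheory.Balaban1983to89.T3ContinuumYM3Torus
import HarnessLib

/-!
# Route `UnitScaleTilt`, crux K1 child «MinimiserStabilityRegPr» (stmt-QuantumFields-19200), leaf V2′ `stub_halvingStep` — PILLAR F4, PART 9:
# **PARTS 6–7 READ AT THE d = 3 CARRIER ON A DOMAIN SEQUENCE `Ω : ℕ → Set (Site (F.P K) 0)` WITH PRINT'S LEVEL WEIGHTS `(L^{j(x)}η)^m`,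
# `η = L^{−(K−n)}`** — the «per level BY NAME» form of [Balaban1985Variational] Prop. 6 for (158) / the (165) entry / Prop. 3's chart on the cube
# sequence (144) (OWNER RULING g20-№13 AMENDMENT A: «F4 p520930/p526716 BY NAME per level»; the domain letter `Ω` of pillar P1
# `stub_thm2CubeSeq` / ym3-torus-p1 g15's `FlatCubeSequence.cubeSet`)

Cell `ym3-torus` (HUMAN RULING D-0037, YM ladder rung R3), seat `ym-ust-19200-f4` gen 0.  `--supports stmt-QuantumFields-19200 --as helper`;
count-neutral; ninth file of pillar F4.

THE PRINT.  p. 286: *«sup_j L^jη sup_{Ω_j}|A′| = |A′|₍₋₁₎»*; (152) p. 301: *«L^jη|A|, (L^jη)²|∇A|, (L^jη)³|∂^{η*}∂^ηA|, (L^jη)³|Δ^ηA| < 9dL²B₁Mε₀ on Ω′_j, j = 0,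
1, …, k»*; (158) p. 302; (165) p. 304.  TYPED READING: the level of a fine site `x` is lit-balaban's `B11Eq115Space.levOf Ω k x` (the largest `j ≤ k`
with `x ∈ Ω j`), a bond is weighted by the level of its SOURCE point, `k = K − n`, `η = L^{−(K−n)}` (carrier units: `L^kη = 1`), and the difference
quotient `∇^η` carries the extra factor `η⁻¹ = L^{K−n}`: «(115)/(152)-size of `A` ≤ r» := `∀ b, (L^{j(b)}η)·‖A b‖ ≤ r` ∧
`∀ b ν, (L^{j(b)}η)²·L^{K−n}·‖A(⟨b₋ + e_ν, μ(b)⟩) − A(b)‖ ≤ r`; «current size of `f` ≤ β» := `∀ b, (L^{j(b)}η)³·‖f b‖ ≤ β`.  The weights are passed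
as a function `w : ℕ → PBond (F.P K) 0 → ℝ` with its defining equation `hw` (instantiate with `rfl`).

WHAT IS PROVED (sorry-free; no definition; axioms standard): **`existsUnique_smallSolution158_dom`** (Prop. 6 for (158) + S-valuedness, in the
level-weighted sizes of any domain sequence `Ω` on the fine torus of run `K`), **`letter_solution158_dom_le`** (the (165) entry for an arbitrary
letter), **`chart47_dom`** (Prop. 3's chart with fine weight `(L^{j(b)}η)` and unweighted block fields).  Proofs: parts 6–7
(`FlatSmallSolution158Levels`, `FlatChart47Levels`) at `src (b, ν) = b`, `tgt (b, ν) = ⟨b₋ + e_ν, μ(b)⟩` and the displayed weights (positivity from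
`0 < L`).  HONEST SCOPE as parts 6–7 (all operators and constants are hypotheses; `Ω` is any sequence — the cube sequence (144), its frozen exterior
and the admissibility (1.3)–(1.4) are pillars P0–P2's); NOT a claim about the mass gap.

References: T. Bałaban, CMP **102** (1985) 277–309 [Balaban1985Variational] p.286, (144) p.300, (152) p.301, (158) p.302, (165) p.304.
-/

set_option autoImplicit false

noncomputable section

namespace Summit.QuantumFields.YangMills.Theorems.FlatSmallSolution158CubeSeq

open Literature.MathematicalPhysics.QuantumFieldTheory.Balaban1983to89
open Literature.MathematicalPhysics.QuantumFieldTheory.Balaban1983to89.B11Eq115Space (levOf)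
open Literature.MathematicalPhysics.QuantumFieldTheory.Balaban1983to89.T3ContinuumYM3Torus (T3Family)
open Summit.QuantumFields.YangMills.Theorems.FlatSmallSolution158Levels (existsUnique_smallSolution158W_valued letter_solution158W_le)
open Summit.QuantumFields.YangMills.Theorems.FlatChart47Levels (chart47W)

variable {V : Type*} [NormedAddCommGroup V] [NormedSpace ℂ V]

/-- The level weights `(L^{j(b)}η)^m`, `η = L^{−(K−n)}`, are positive. [cite: Balaban1985Variational, p.286] -/
theorem levWeight_dom_pos (F : T3Family) (n K : ℕ) (Ω : ℕ → Set (Site (F.P K) 0)) (w : ℕ → PBond (F.P K) 0 → ℝ)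
    (hw : ∀ m b, w m b = ((F.L : ℝ) ^ levOf Ω (K - n) b.src * ((F.L : ℝ)⁻¹) ^ (K - n)) ^ m) (m : ℕ) (b : PBond (F.P K) 0) :
    0 < w m b := by
  have hL : (0 : ℝ) < F.L := by exact_mod_cast lt_trans zero_lt_one F.hL.2
  rw [hw]
  exact pow_pos (mul_pos (pow_pos hL _) (pow_pos (inv_pos.2 hL) _)) m

/-- **[Balaban1985Variational] PROP. 6 FOR (158) ON A DOMAIN SEQUENCE AT THE d = 3 CARRIER, LEVEL-WEIGHTED (152)-SIZES** (weights
`w m b = (L^{j(b)}η)^m`, `j(b) = levOf Ω (K−n) b₋`, `η = L^{−(K−n)}`): for `G̃` with «current size `f` ≤ β ⇒ size `G̃f` ≤ B₀β» (pillar P2's letters on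
the cube sequence), `W` with Prop. 4's (98) pointwise and holomorphy on the size-ball of radius `a₃` (pillar P3), `𝔄 = HB` of size `< a`, `0 < a ≤ ε₄`,
`4ε₄ ≤ a₃`, `16B₀C₄ε₄ ≤ 1`: EXACTLY ONE `A₁` of size `≤ ε₄` solves `A₁ + G̃(W(A₁ + 𝔄)) = 0`, and every such solution is `S`-valued for every closed
invariant value set `S ∋ 0` (reality).  [cite: Balaban1985Variational, Prop. 6 p.295, (152) p.301, (158) p.302] -/
theorem existsUnique_smallSolution158_dom [FiniteDimensional ℂ V] (F : T3Family) (n K : ℕ) (Ω : ℕ → Set (Site (F.P K) 0))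
    (w : ℕ → PBond (F.P K) 0 → ℝ) (hw : ∀ m b, w m b = ((F.L : ℝ) ^ levOf Ω (K - n) b.src * ((F.L : ℝ)⁻¹) ^ (K - n)) ^ m)
    (G : (PBond (F.P K) 0 → V) →ₗ[ℂ] (PBond (F.P K) 0 → V)) (W : (PBond (F.P K) 0 → V) → (PBond (F.P K) 0 → V))
    {B₀ C₄ a₃ a ε₄ : ℝ} (hB₀ : 0 ≤ B₀) (hC₄ : 0 ≤ C₄)
    (hG : ∀ (f : PBond (F.P K) 0 → V) (β : ℝ), (∀ b, w 3 b * ‖f b‖ ≤ β) →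
      (∀ b, w 1 b * ‖G f b‖ ≤ B₀ * β) ∧
        ∀ (b : PBond (F.P K) 0) (ν : Fin 3), w 2 b * (F.L : ℝ) ^ (K - n) * ‖G f ⟨b.src.shift ν, b.dir⟩ - G f b‖ ≤ B₀ * β)
    (hWq : ∀ (Y : PBond (F.P K) 0 → V) (r : ℝ), r < a₃ → (∀ b, w 1 b * ‖Y b‖ ≤ r) →
      (∀ (b : PBond (F.P K) 0) (ν : Fin 3), w 2 b * (F.L : ℝ) ^ (K - n) * ‖Y ⟨b.src.shift ν, b.dir⟩ - Y b‖ ≤ r) →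
        ∀ b, w 3 b * ‖W Y b‖ ≤ C₄ * r ^ 2)
    (hWd : DifferentiableOn ℂ W {Y : PBond (F.P K) 0 → V | (∀ b, w 1 b * ‖Y b‖ < a₃) ∧
      ∀ (b : PBond (F.P K) 0) (ν : Fin 3), w 2 b * (F.L : ℝ) ^ (K - n) * ‖Y ⟨b.src.shift ν, b.dir⟩ - Y b‖ < a₃})
    (𝔄 : PBond (F.P K) 0 → V) (ha0 : 0 < a) (h𝔄 : ∀ b, w 1 b * ‖𝔄 b‖ < a)
    (h𝔄' : ∀ (b : PBond (F.P K) 0) (ν : Fin 3), w 2 b * (F.L : ℝ) ^ (K - n) * ‖𝔄 ⟨b.src.shift ν, b.dir⟩ - 𝔄 b‖ < a)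
    (ha : a ≤ ε₄) (hε₄ : 0 ≤ ε₄) (h2 : 4 * ε₄ ≤ a₃) (h3 : 16 * B₀ * C₄ * ε₄ ≤ 1) :
    (∃! A₁ : PBond (F.P K) 0 → V, ((∀ b, w 1 b * ‖A₁ b‖ ≤ ε₄) ∧
        ∀ (b : PBond (F.P K) 0) (ν : Fin 3), w 2 b * (F.L : ℝ) ^ (K - n) * ‖A₁ ⟨b.src.shift ν, b.dir⟩ - A₁ b‖ ≤ ε₄) ∧
      A₁ + G (W (A₁ + 𝔄)) = 0) ∧
    ∀ (S : Set V), IsClosed S → (0 : V) ∈ S →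
      (∀ X : PBond (F.P K) 0 → V, (∀ b, X b ∈ S) → (∀ b, w 1 b * ‖X b‖ ≤ ε₄) →
        (∀ (b : PBond (F.P K) 0) (ν : Fin 3), w 2 b * (F.L : ℝ) ^ (K - n) * ‖X ⟨b.src.shift ν, b.dir⟩ - X b‖ ≤ ε₄) →
          ∀ b, -(G (W (X + 𝔄)) b) ∈ S) →
      ∀ A₁ : PBond (F.P K) 0 → V, ((∀ b, w 1 b * ‖A₁ b‖ ≤ ε₄) ∧
          ∀ (b : PBond (F.P K) 0) (ν : Fin 3), w 2 b * (F.L : ℝ) ^ (K - n) * ‖A₁ ⟨b.src.shift ν, b.dir⟩ - A₁ b‖ ≤ ε₄) →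
        A₁ + G (W (A₁ + 𝔄)) = 0 → ∀ b, A₁ b ∈ S := by
  have hL : (0 : ℝ) < F.L := by exact_mod_cast lt_trans zero_lt_one F.hL.2
  have hpos := levWeight_dom_pos F n K Ω w hw
  -- pair structure κ = bond × direction, weights w 1, (w 2)·L^{K−n}, w 3
  have h := existsUnique_smallSolution158W_valued (ι := PBond (F.P K) 0) (κ := PBond (F.P K) 0 × Fin 3) (V := V)
    (fun p => p.1) (fun p => (⟨p.1.src.shift p.2, p.1.dir⟩ : PBond (F.P K) 0))
    (w₀ := w 1) (w₃ := w 3) (w₁ := fun p => w 2 p.1 * (F.L : ℝ) ^ (K - n))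
    (hpos 1) (fun p => mul_pos (hpos 2 p.1) (pow_pos hL _)) (hpos 3) G W hB₀ hC₄
    (fun f β hf => ⟨(hG f β hf).1, fun p => (hG f β hf).2 p.1 p.2⟩)
    (fun Y r hr h1 h2 => hWq Y r hr h1 (fun b ν => h2 (b, ν)))
    (by
      have e : {Y : PBond (F.P K) 0 → V | (∀ b, w 1 b * ‖Y b‖ < a₃) ∧
          ∀ p : PBond (F.P K) 0 × Fin 3, w 2 p.1 * (F.L : ℝ) ^ (K - n) * ‖Y ⟨p.1.src.shift p.2, p.1.dir⟩ - Y p.1‖ < a₃} =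
          {Y : PBond (F.P K) 0 → V | (∀ b, w 1 b * ‖Y b‖ < a₃) ∧
          ∀ (b : PBond (F.P K) 0) (ν : Fin 3), w 2 b * (F.L : ℝ) ^ (K - n) * ‖Y ⟨b.src.shift ν, b.dir⟩ - Y b‖ < a₃} := by
        ext Y; simp only [Set.mem_setOf_eq, Prod.forall]
      rw [e]; exact hWd)
    𝔄 ha0 h𝔄 (fun p => h𝔄' p.1 p.2) ha hε₄ h2 h3
  refine ⟨?_, fun S hS h0 hinv A₁ hA₁ hsol b => ?_⟩
  · obtain ⟨A₁, ⟨hsz, hsol⟩, huniq⟩ := h.1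
    refine ⟨A₁, ⟨⟨hsz.1, fun b ν => hsz.2 (b, ν)⟩, hsol⟩, fun A₁' hA₁' => huniq A₁' ⟨⟨hA₁'.1.1, fun p => hA₁'.1.2 p.1 p.2⟩, hA₁'.2⟩⟩
  · exact h.2 S hS h0 (fun X hX h1 h2 => hinv X hX h1 (fun b' ν => h2 (b', ν))) A₁ ⟨hA₁.1, fun p => hA₁.2 p.1 p.2⟩ hsol b

/-- **THE (165) ENTRY ON A DOMAIN SEQUENCE, LEVEL-WEIGHTED, ANY LETTER**: `N(−G̃f) ≤ B_N·β` under «current size `f` ≤ β» and Prop. 4's (98) give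
`N(A₁) ≤ B_N·C₄ρ²` for every solution of (158) with size(`A₁ + 𝔄`) `≤ ρ < a₃` (print `ρ = 36dL²B₁Mε₀`; the four sizes of (165) = four letters `N`).
[cite: Balaban1985Variational, (165) p.304, (152) p.301] -/
theorem letter_solution158_dom_le (F : T3Family) (n K : ℕ) (w : ℕ → PBond (F.P K) 0 → ℝ)
    (G : (PBond (F.P K) 0 → V) →ₗ[ℂ] (PBond (F.P K) 0 → V)) (W : (PBond (F.P K) 0 → V) → (PBond (F.P K) 0 → V))
    {C₄ a₃ ρ : ℝ}
    (hWq : ∀ (Y : PBond (F.P K) 0 → V) (r : ℝ), r < a₃ → (∀ b, w 1 b * ‖Y b‖ ≤ r) →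
      (∀ (b : PBond (F.P K) 0) (ν : Fin 3), w 2 b * (F.L : ℝ) ^ (K - n) * ‖Y ⟨b.src.shift ν, b.dir⟩ - Y b‖ ≤ r) →
        ∀ b, w 3 b * ‖W Y b‖ ≤ C₄ * r ^ 2)
    {A₁ 𝔄 : PBond (F.P K) 0 → V} (hsol : A₁ + G (W (A₁ + 𝔄)) = 0) (hρ : ρ < a₃)
    (h1 : ∀ b, w 1 b * ‖(A₁ + 𝔄) b‖ ≤ ρ)
    (h2 : ∀ (b : PBond (F.P K) 0) (ν : Fin 3), w 2 b * (F.L : ℝ) ^ (K - n) * ‖(A₁ + 𝔄) ⟨b.src.shift ν, b.dir⟩ - (A₁ + 𝔄) b‖ ≤ ρ)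
    (N : (PBond (F.P K) 0 → V) → ℝ) {B : ℝ}
    (hN : ∀ (f : PBond (F.P K) 0 → V) (β : ℝ), (∀ b, w 3 b * ‖f b‖ ≤ β) → N (-(G f)) ≤ B * β) :
    N A₁ ≤ B * (C₄ * ρ ^ 2) :=
  letter_solution158W_le (ι := PBond (F.P K) 0) (κ := PBond (F.P K) 0 × Fin 3) (fun p => p.1)
    (fun p => (⟨p.1.src.shift p.2, p.1.dir⟩ : PBond (F.P K) 0)) (w₀ := w 1) (w₃ := w 3)
    (w₁ := fun p => w 2 p.1 * (F.L : ℝ) ^ (K - n)) G W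
    (fun Y r hr ha hb => hWq Y r hr ha (fun b ν => hb (b, ν))) hsol hρ h1 (fun p => h2 p.1 p.2) N hN

/-- **PROP. 3's CHART ON A DOMAIN SEQUENCE AT THE d = 3 CARRIER, LEVEL-WEIGHTED** (fine weight `w 1 b = L^{j(b)}η`, block fields on
`PBond (F.P K) (K − n)` unweighted — print's `|X| < ε₃/B₀ on 𝔅_k`): `FlatChart47Levels.chart47W` read at these letters — ∃! `D` of size `≤ 4C₂ε²` with
`C(A′ − HD) = D`, (55), and the linearization (48). [cite: Balaban1985Variational, Prop. 3 p.289, (47)-(55) pp.285-286, (156)-(157) p.302] -/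
theorem chart47_dom [FiniteDimensional ℂ V] (F : T3Family) (n K : ℕ) (Ω : ℕ → Set (Site (F.P K) 0))
    (w : ℕ → PBond (F.P K) 0 → ℝ) (hw : ∀ m b, w m b = ((F.L : ℝ) ^ levOf Ω (K - n) b.src * ((F.L : ℝ)⁻¹) ^ (K - n)) ^ m)
    {β' : Type*} [Fintype β'] (C : (PBond (F.P K) 0 → V) → (β' → V)) (H : (β' → V) →ₗ[ℂ] (PBond (F.P K) 0 → V))
    {C₂ R B₀ ε : ℝ} (hC₂ : 0 ≤ C₂) (hB₀ : 0 ≤ B₀)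
    (hH : ∀ (X : β' → V) (t : ℝ), (∀ c, ‖X c‖ ≤ t) → ∀ b, w 1 b * ‖H X b‖ ≤ B₀ * t)
    (hCq : ∀ (Y : PBond (F.P K) 0 → V) (r : ℝ), r < R → (∀ b, w 1 b * ‖Y b‖ ≤ r) → ∀ c, ‖C Y c‖ ≤ C₂ * r ^ 2)
    (hCd : DifferentiableOn ℂ C {Y : PBond (F.P K) 0 → V | ∀ b, w 1 b * ‖Y b‖ < R})
    (hq : 9 * C₂ * B₀ * ε < 1) (hR : 3 * ε ≤ R) (hε : 0 < ε) (A' : PBond (F.P K) 0 → V) (hA' : ∀ b, w 1 b * ‖A' b‖ < ε) :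
    ∃ D : β' → V,
      ((∀ c, ‖D c‖ ≤ 4 * C₂ * ε ^ 2) ∧ C (A' - H D) = D) ∧
      (∀ D' : β' → V, (∀ c, ‖D' c‖ ≤ 4 * C₂ * ε ^ 2) → C (A' - H D') = D' → D' = D) ∧
      (∀ ρ : ℝ, 0 ≤ ρ → (∀ b, w 1 b * ‖A' b‖ ≤ ρ) → ∀ c, ‖D c‖ ≤ 4 * C₂ * ρ ^ 2) ∧
      ∀ (Qlin : (PBond (F.P K) 0 → V) →ₗ[ℂ] (β' → V)), (∀ X, Qlin (H X) = X) →
        Qlin (A' - H D) + C (A' - H D) = Qlin A' := by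
  have hpos := levWeight_dom_pos F n K Ω w hw
  have h := chart47W (ι := PBond (F.P K) 0) (β := β') (V := V) (w₀ := w 1) (wB := fun _ => (1 : ℝ)) (hpos 1) (fun _ => one_pos)
    C H hC₂ hB₀ (fun X t hX => hH X t (fun c => by simpa using hX c))
    (fun Y r hr hY c => by simpa using hCq Y r hr hY c) hCd hq hR hε A' hA'
  obtain ⟨D, ⟨hDb, hDfix⟩, hDuniq, h55, h48⟩ := h
  refine ⟨D, ⟨fun c => by simpa using hDb c, hDfix⟩, fun D' hD' hfix' => hDuniq D' (fun c => by simpa using hD' c) hfix',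
    fun ρ hρ hA'ρ c => by simpa using h55 ρ hρ hA'ρ c, h48⟩

end Summit.QuantumFields.YangMills.Theorems.FlatSmallSolution158CubeSeq

end
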